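import Mathlib
import HarnessLib
import Summits.CriticalPhenomena.SAWScalingLimit.Theorems.SAWDevelopingMapPotentialExistsExtension
import Literature.Barriers.CriticalPhenomena.ParafermionicHalfCauchyRiemann

/-!
# Face potentials on a simply connected hexagonal domain — the Jordan-type input (helper, line
`eight_fifths_primitive`)

Helper sub-goal (B) (wave 5) of the stub `stub_rayCondition` of line `eight_fifths_primitive`, crux
`QCIdentification` (stmt-CriticalPhenomena-16772); namespace of the checked skeleton, sub-namespace
`FacePot`.  The branch-consistent global lift of the phases `arg (S_w / S_v)` across adjacent faces
of the source component is a FACE POTENTIAL: a function `θ` on the faces of `𝕋` (= vertices of the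
honeycomb lattice `ℍ`, `HexVertex`) with prescribed antisymmetric increments `d v w` across adjacent
faces `v ∼ w` of `Λ`.  It exists as soon as the increments have zero circulation around every
COMPLETE hexagon of `Λ` (all six faces `HexKernel.face s j` around a site `s` in `Λ`) — the dual
discrete Poincaré lemma, proved in the sibling file `…FacePotential.lean` by induction on `|Λ|`
removing the topmost face, exactly as the primal lemma `PotentialExists.exists_potential`
(`SAWDevelopingMapPotentialExists{Topology,Extension,Poincare}.lean`).

**This file: the one global input of that induction** (registered `fp_hexagon_complete_of_joined`).
Let the complement of `Λ` be connected in `ℍ` (`hexDomainSimplyConnected Λ`), let the down face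
`v = (y, 1) ∈ Λ` have its upper neighbour `u = (y + e₁, 0)` outside `Λ`, and suppose its two lower
neighbours `w₁ = (y, 0)`, `w₂ = (y + e₀, 0)` are joined by a chain of pairwise adjacent faces of
`Λ ∖ {v}`.  Then the hexagon of `ℍ` centred at the site `s = y + e₀` — whose faces `0, 1, 2` are
`w₂, v, w₁` — is COMPLETE: all six faces `HexKernel.face s j` lie in `Λ`.

*Proof.*  A simple path `w₁ → ⋯ → w₂` in `Λ ∖ {v}` closes up through `v` to a simple cycle `l` of `ℍ`
(coordinate model `HV`, `HexSAWWinding.lean`) traversing the two hexagon darts `w₂ → v → w₁`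
counter-clockwise around `s`, so the winding number `HV.wnd l` drops by `1` from the hexagon `s` to
the hexagon `s + e₁` across the dart `w₂ → v` (`HV.wnd_left_sub_right`, `HV.IsCyc.flux_eq_one`).
If some face `f` of the hexagon were missing from `Λ`, a path from `f` to `u` in the (connected)
complement of `Λ` would avoid the cycle, and along such a path the winding number of the adjacent
hexagons is constant (`HV.wnd_faces_at_eq`); but `f` is adjacent to the hexagon `s` and `u` to the
hexagon `s + e₁` — contradiction.

Sources: folklore (winding numbers of lattice cycles; the cycle space of a plane graph with
connected complement is generated by its bounded faces, cf. Bondy–Murty, *Graph Theory* (2008),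
§10 (cycle spaces of planar graphs)); H. Duminil-Copin, S. Smirnov, Ann. of Math. 175 (2012),
§2 ("simply connected, i.e. having a connected complement").
-/

noncomputable section

open Literature.Probability.LatticeModels Literature.Probability.RandomPlanarGeometry
open Literature.Probability.RandomPlanarGeometry.SAW
open Literature.Barriers.CriticalPhenomena

namespace Summit.CriticalPhenomena.SAWScalingLimit.Cruxes.QCIdentification.EightFifthsPrimitive

namespace FacePot

/-! ### Coordinates of the hexagon faces -/

/-- The `j`-th face around the site `s` is, in the coordinate model `HV`, the `(j+1)`-st vertex of
the hexagon centred at `(s 0, s 1)`. -/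
theorem toHV_face (s : Site 2) (j : Fin 6) :
    toHV (HexKernel.face s j) = HV.hexV (s 0, s 1) (j + 1) := by
  fin_cases j <;> simp [HexKernel.face, HV.hexV, toHV, Pi.sub_apply]

/-- `toHV` is injective. -/
theorem toHV_injective : Function.Injective toHV := fun a b h => by
  simpa using congrArg ofHV h

/-! ### Chains of adjacent faces of a finite set give walks in the induced graph -/

/-- A chain of pairwise adjacent faces of `Λ'` from `a ∈ Λ'` to `b` is a walk from `a` to `b` in the
subgraph of `ℍ` induced on `Λ'`. -/
theorem reachable_of_reflTransGen {Λ' : Finset HexVertex} {a b : HexVertex} (ha : a ∈ Λ')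
    (h : Relation.ReflTransGen (fun p q : HexVertex => p ∈ Λ' ∧ q ∈ Λ' ∧ hexGraph.Adj p q) a b) :
    ∃ hb : b ∈ Λ', (hexGraph.induce (↑Λ' : Set HexVertex)).Reachable ⟨a, by simpa using ha⟩
      ⟨b, by simpa using hb⟩ := by
  induction h with
  | refl => exact ⟨ha, SimpleGraph.Reachable.refl _⟩
  | tail _ hbc ih =>
    obtain ⟨hb, hr⟩ := ih
    refine ⟨hbc.2.1, hr.trans (SimpleGraph.Adj.reachable ?_)⟩
    exact SimpleGraph.induce_adj.2 hbc.2.2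

/-! ### Propagation of the winding number along a walk off the cycle -/

/-- Along a walk of `ℍ` inside a vertex set `S` disjoint from the closed dart sequence `l`, the
winding number of `l` around the hexagons at the vertices of the walk is constant: for any
neighbours `t` of the start and `t'` of the end, the hexagons to the left of the two darts have the
same winding number (`HV.wnd_faces_at_eq`, iterated). -/
theorem wnd_leftFace_eq_of_walk {l : List HV} (hl : ∀ d ∈ HV.cdarts l, hvGraph.Adj d.1 d.2)
    {S : Set HexVertex} (hS : ∀ q ∈ S, toHV q ∉ l) {a b : S}
    (p : (hexGraph.induce S).Walk a b) :
    ∀ t t' : HV, hvGraph.Adj (toHV a.1) t → hvGraph.Adj (toHV b.1) t' →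
      HV.wnd l (HV.leftFace (toHV a.1) t) = HV.wnd l (HV.leftFace (toHV b.1) t') := by
  induction p with
  | nil =>
    intro t t' ht ht'
    rw [HV.wnd_faces_at_eq hl (hS _ (Subtype.coe_prop _)) ht ht',
      HV.wnd_faces_at_eq hl (hS _ (Subtype.coe_prop _)) ht' ht']
  | cons hadj p ih =>
    intro t t' ht ht'
    have hac := (hexGraph_adj_iff_hvGraph_adj _ _).1 (SimpleGraph.induce_adj.1 hadj)
    rw [HV.wnd_faces_at_eq hl (hS _ (Subtype.coe_prop _)) ht hac]
    exact ih _ _ hac.symm ht'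

/-! ### The Jordan-type input: a chain below a boundary face closes a complete hexagon -/

/-- **Jordan-type input of the dual discrete Poincaré lemma.**  Let the complement of `Λ` be
connected in `ℍ`, let `(y, 1) ∈ Λ` with `(y + e₁, 0) ∉ Λ`, and let the two lower neighbours
`(y, 0)`, `(y + e₀, 0)` of `(y, 1)` be joined by a chain of pairwise adjacent faces of
`Λ ∖ {(y, 1)}`.  Then all six faces of the hexagon centred at the site `y + e₀` lie in `Λ`. -/
theorem fp_hexagon_complete_of_joined : ∀ (Λ : Finset HexVertex), hexDomainSimplyConnected Λ →
    ∀ y : Site 2, (y, (1 : Fin 2)) ∈ Λ → (y + Pi.single 1 1, (0 : Fin 2)) ∉ Λ →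
    Relation.ReflTransGen
      (fun p q : HexVertex => p ∈ Λ.erase (y, 1) ∧ q ∈ Λ.erase (y, 1) ∧ hexGraph.Adj p q)
      (y, 0) (y + Pi.single 0 1, 0) →
    ∀ j : Fin 6, HexKernel.face (y + Pi.single 0 1) j ∈ Λ := by
  classical
  intro Λ hΛ y hv hu hreach j
  by_contra hf
  set e0 : Site 2 := Pi.single 0 1 with he0
  set e1 : Site 2 := Pi.single 1 1 with he1
  set h : ℤ × ℤ := ((y + e0) 0, (y + e0) 1) with hh
  -- coordinates of the three faces `w₂, v, w₁` of the hexagon and of the outer face `u`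
  have cv : toHV ((y, 1) : HexVertex) = HV.hexV h (1 + 1) := by
    simp [toHV, HV.hexV, hh, he0]
  have cw₁ : toHV ((y, 0) : HexVertex) = HV.hexV h (1 + 1 + 1) := by
    simp [toHV, HV.hexV, hh, he0]
  have cw₂ : toHV ((y + e0, 0) : HexVertex) = HV.hexV h 1 := by
    simp [toHV, HV.hexV, hh, he0]
  have cu : HV.leftFace (toHV ((y + e1, 0) : HexVertex)) (toHV ((y, 1) : HexVertex)) =
      HV.hexN h 1 := by
    simp [toHV, HV.leftFace, HV.hexN, hh, he0, he1]
  -- the chain is nonempty: membership of its ends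
  have hne : ((y, 0) : HexVertex) ≠ (y + e0, 0) := by
    intro e; have := congrArg (fun f : HexVertex => f.1 0) e; simp [he0] at this
  rcases Relation.reflTransGen_iff_eq_or_transGen.1 hreach with heq | htrans
  · exact hne heq.symm
  obtain ⟨_, hfirst, -⟩ := Relation.TransGen.head'_iff.1 htrans
  have hw₁ : ((y, 0) : HexVertex) ∈ Λ.erase (y, 1) := hfirst.1
  obtain ⟨hw₂, hr⟩ := reachable_of_reflTransGen hw₁ hreach
  -- a simple path `w₁ → ⋯ → w₂` in `Λ ∖ {v}`
  obtain ⟨P⟩ := hr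
  set Q := P.bypass with hQ
  have hQp : Q.IsPath := P.bypass_isPath
  set M : List HV := Q.support.tail.map fun z => toHV z.1 with hM
  have hsupp : Q.support.map (fun z => toHV z.1) = toHV (y, 0) :: M := by
    rw [hM]
    nth_rw 1 [← Q.cons_tail_support]
    rfl
  -- the cycle `v, w₁, …, w₂`
  set l : List HV := toHV ((y, 1) : HexVertex) :: toHV ((y, 0) : HexVertex) :: M with hl
  have hmemM : ∀ z ∈ toHV ((y, 0) : HexVertex) :: M, ∃ q ∈ Λ.erase (y, 1), toHV q = z := by
    intro z hz
    rw [← hsupp, List.mem_map] at hz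
    obtain ⟨q, -, rfl⟩ := hz
    exact ⟨q.1, by simp, rfl⟩
  have hchain : (toHV ((y, 0) : HexVertex) :: M).IsChain hvGraph.Adj := by
    rw [← hsupp, List.isChain_map]
    exact List.IsChain.imp (fun a b hab => (hexGraph_adj_iff_hvGraph_adj _ _).1 hab)
      Q.isChain_adj_support
  have hlast : (toHV ((y, 0) : HexVertex) :: M).getLast (List.cons_ne_nil _ _) =
      toHV ((y + e0, 0) : HexVertex) := by
    simp only [← hsupp, List.getLast_map, Q.getLast_support]
  have hadj₁ : hexGraph.Adj ((y, 1) : HexVertex) (y, 0) :=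
    (hexGraph_adj_iff_of_snd_eq_one y y).2 (Or.inl rfl)
  have hadj₂ : hexGraph.Adj ((y, 1) : HexVertex) (y + e0, 0) :=
    (hexGraph_adj_iff_of_snd_eq_one y _).2 (Or.inr (Or.inl rfl))
  have hadju : hexGraph.Adj ((y + e1, 0) : HexVertex) (y, 1) :=
    ((hexGraph_adj_iff_of_snd_eq_one y _).2 (Or.inr (Or.inr rfl))).symm
  have hadj : ∀ d ∈ HV.cdarts l, hvGraph.Adj d.1 d.2 := by
    intro d hd
    rw [hl, HV.cdarts_cons_cons, List.mem_append, List.mem_cons, List.mem_singleton] at hd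
    rcases hd with (rfl | hd) | rfl
    · exact (hexGraph_adj_iff_hvGraph_adj _ _).1 hadj₁
    · exact HV.adj_of_mem_pdarts hchain d hd
    · rw [hlast]
      exact (hexGraph_adj_iff_hvGraph_adj _ _).1 hadj₂.symm
  have hvl : ∀ q : HexVertex, toHV q ∈ l → q ∈ Λ := by
    intro q hq
    rw [hl, List.mem_cons] at hq
    rcases hq with hq | hq
    · rwa [toHV_injective hq]
    · obtain ⟨q', hq', he⟩ := hmemM _ hq
      rw [← toHV_injective he]
      exact Finset.mem_of_mem_erase hq'
  have hcyc : HV.IsCyc l := by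
    refine ⟨?_, ?_, hadj⟩
    · rw [hl, List.length_cons, List.length_cons, hM, List.length_map, List.length_tail,
        SimpleGraph.Walk.length_support]
      have : Q.length ≠ 0 := fun h0 => hne (by
        have := SimpleGraph.Walk.eq_of_length_eq_zero h0
        simpa using congrArg Subtype.val this)
      omega
    · rw [hl, List.nodup_cons]
      refine ⟨fun hmem => ?_, ?_⟩
      · obtain ⟨q', hq', he⟩ := hmemM _ hmem
        rw [toHV_injective.eq_iff] at he
        subst he
        simp at hq'
      · rw [← hsupp]
        exact hQp.support_nodup.map (toHV_injective.comp Subtype.val_injective)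
  -- the winding number drops by one across the dart `w₂ → v`
  have hmem : (toHV ((y + e0, 0) : HexVertex), toHV ((y, 1) : HexVertex)) ∈ HV.cdarts l := by
    rw [hl, HV.cdarts_cons_cons, List.mem_append, List.mem_singleton, hlast]
    exact Or.inr rfl
  have hjump := HV.wnd_left_sub_right hadj ((hexGraph_adj_iff_hvGraph_adj _ _).1 hadj₂.symm)
  rw [hcyc.flux_eq_one hmem, cw₂, cv, HV.leftFace_hexV, HV.rightFace_hexV] at hjump
  -- a path from the missing face to `u` in the complement of `Λ`, off the cycle
  obtain ⟨P'⟩ := hΛ ⟨HexKernel.face (y + e0) j, by simpa using hf⟩ ⟨(y + e1, 0), by simpa using hu⟩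
  have hS : ∀ q ∈ ((↑Λ : Set HexVertex)ᶜ), toHV q ∉ l := fun q hq hql => hq (hvl q hql)
  have hprop := wnd_leftFace_eq_of_walk hadj hS P' (HV.hexV h (j + 1 + 1)) (toHV ((y, 1) : HexVertex))
    (by rw [toHV_face]; exact HV.adj_hexV_succ h (j + 1))
    ((hexGraph_adj_iff_hvGraph_adj _ _).1 hadju)
  rw [toHV_face, ← hh, HV.leftFace_hexV, cu] at hprop
  omega

end FacePot

end Summit.CriticalPhenomena.SAWScalingLimit.Cruxes.QCIdentification.EightFifthsPrimitive

end
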